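/-
Origin: expansion seat `prover-pub-hodgecm-mc-binder-1-g18-0`, handover #R126 2026-08-21T02:09:41Z md5 2ae516bae0a2 (313 l.; NEW additive MODEL leaf, ns HodgeCM.Model.ThetaAdelicSide; imports PKG #R124 Model/AdelicThetaDistributionMultEnd (RUN 67) + sinst-1-g11 #1259 Model/AdelicThetaDistributionEnd34 (RUN 69) + INSTALLED carch #CA44 Model/ArchKTypeOfDefiniteChar34 + carch #CA68 Model/ArchKTypeOfMultOneDatum34 (RUN 69); DROP-ALONE (nothing imports it); 0 records, 0 `def … : Prop`, two data defs (`archOpTwo/Three`), nothing cited; = the SLOT-2/3 CLONE of #R124 §2 (same statements with Zero/One ↦ Two/Three, `lineOmega_two/three … hGR hGR₂ hGR₃ (eta₂/eta₃ …)`, `dW′`, `finRepTwo/Three`, `.P 2/3`); NAMES for audit: HodgeCM.Model.ThetaAdelicSide.archSideOf_ω_two_regime_archToAdelic · HodgeCM.Model.ThetaAdelicSide.clsU_mem_iSup_block_of_mem_holSat_archSideOf_two_of_ne_zero · HodgeCM.Model.ThetaAdelicSide.clsU_mem_iSup_block_of_mem_holSat_archSideOf_three_of_ne_zero; NAME LIST: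 HodgeCM.Model.ThetaAdelicSide.archSideOf_ω_two_regime_archToAdelic · HodgeCM.Model.ThetaAdelicSide.clsU_mem_iSup_block_of_mem_holSat_archSideOf_two_of_ne_zero · HodgeCM.Model.ThetaAdelicSide.clsU_mem_iSup_block_of_mem_holSat_archSideOf_three_of_ne_zero; all decls: HodgeCM.Model.ThetaAdelicSide.archOpTwo (def) · HodgeCM.Model.ThetaAdelicSide.archOpThree (def) · HodgeCM.Model.ThetaAdelicSide.archSideOf_ω_two_regime_archToAdelic · HodgeCM.Model.ThetaAdelicSide.archSideOf_ω_three_regime_archToAdelic · HodgeCM.Model.ThetaAdelicSide.exists_eq_dist_of_mem_holSat_archSideOf_two · HodgeCM.Model.ThetaAdelicSide.exists_eq_dist_of_mem_holSat_archSideOf_three · HodgeCM.Model.ThetaAdelicSide.clsU_mem_iSup_block_of_mem_holSat_archSideOf_two · HodgeCM.Model.ThetaAdelicSide.clsU_mem_iSup_block_of_mem_holSat_archSideOf_three · HodgeCM.Model.ThetaAdelicSide.clsU_mem_iSup_block_of_mem_holSat_archSideOf_two_of_rank_le_one · HodgeCM.Model.ThetaAdelicSide.clsU_mem_iSup_block_of_mem_holSat_archSideOf_three_of_rank_le_one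 · HodgeCM.Model.ThetaAdelicSide.clsU_mem_iSup_block_of_mem_holSat_archSideOf_two_of_ne_zero · HodgeCM.Model.ThetaAdelicSide.clsU_mem_iSup_block_of_mem_holSat_archSideOf_three_of_ne_zero) (`HOME/mc/pub-hodgecm-mc-binder-1-g18/stage70/HodgeCM/Model/AdelicThetaDistributionMultEnd34.lean`, md5 2ae516bae0a2, 313 lines);
landed by the second packager p2 gen 17 (p2-g17) in gate run 70 as `HodgeCM/Model/AdelicThetaDistributionMultEnd34.lean` (verbatim).
-/
/-
Copyright (c) 2026 the pub-hodgecm formalisation cell (harness21).  New file, not vendored.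
Origin: session prover-pub-hodgecm-mc-binder-1-g18-0 (unit pub-hodgecm-mc-binder-1-g18, BINDER PROVER gen 18; SLOTS 2 AND 3 of the (J4-mult1)
junction at the honest adelic side — the mechanical clone of #R124 § 2 over sinst-1's slot-2/3 product Weil data `thetaDistDatumTwoOf/ThreeOf`
(#1258) and block clause (#1259), with `har` discharged by carch #CA44 `lineRepOf_two/three_regime_archToAdelicG`), 2026-08-21.
Intended final place: `HodgeCM/Model/AdelicThetaDistributionMultEnd34.lean` (NEW additive model-layer leaf; imports binder-1's
`HodgeCM.Model.AdelicThetaDistributionMultEnd` (#R124, § 1 generic), sinst-1's `HodgeCM.Model.AdelicThetaDistributionEnd34` (#1259) and carch's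
`HodgeCM.Model.ArchKTypeOfDefiniteChar34` (#CA44) / `HodgeCM.Model.ArchKTypeOfMultOneDatum34` (#CA68, RUN 69); nothing imports it; drop alone).
-/
import Summits.HodgeConjecture.HodgeCM.Model.AdelicThetaDistributionMultEnd
import Summits.HodgeConjecture.HodgeCM.Model.AdelicThetaDistributionEnd34
import Summits.HodgeConjecture.HodgeCM.Model.ArchKTypeOfDefiniteChar34
import Summits.HodgeConjecture.HodgeCM.Model.ArchKTypeOfMultOneDatum34

set_option autoImplicit false

/-!
# `hfam` clause 2 for every theta form of slots 2 and 3 of the honest side, modulo multiplicity one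

E's `hΘ` quantifies over all four slots `i : Fin 4`; #R124 § 2 / #R125 serve slots 0/1.  This file is the slot-2/3 twin of #R124 § 2:
* `archOpTwo/Three … aa := c₂/c₃(aa′) • ω_∞(aa′, 1)` on the conjugated lines `⟨dW′ 0⟩` / `⟨dW′ 1⟩` (carch `archScalar_twoG/threeG`,
  `cmArchWeilRep … hGR₂/hGR₃`), **`archSideOf_ω_two/three_regime_archToAdelic`** = `har` DISCHARGED (#CA44);
* `exists_eq_dist_of_mem_holSat_archSideOf_two/three` and **`clsU_mem_iSup_block_of_mem_holSat_archSideOf_two/three`** (family-form `hmult`)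
  + `…_of_rank_le_one (hΦ) (hrk)` — EVERY `F ∈ (archSideOf …).holSat hV k Γ 𝓕`, `k = 2, 3`, has its tower class in
  `⨆_{χ, charInv χ ∈ 𝓕} block(Ω_k(χ))`, hypotheses = #1259's `Φarch/harm/hdef/hd/hCR` + `h𝓕` + `hι` + the (J4-mult1) input
  (`hrk : Module.rank ℂ ↥((thetaDistDatumTwoOf/ThreeOf …).admFamilies (archOpTwo/Three …)) ≤ 1`, carch's slot-2/3 target; cores #CA64
  `rank_le_one_of_lineOmega_two/three`);
* § 2 **`clsU_mem_iSup_block_of_mem_holSat_archSideOf_two/three_of_ne_zero (hΦ : Φarch ≠ 0)`** — the end statements with `hrk` STRUCK by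
  carch #CA68 `rank_admFamilies_thetaDistDatumTwoOf/ThreeOf_le_one … ωar Φ harm hdef har` (every `(ωar, har)`; #CA64
  `rank_le_one_of_lineOmega_two/three`) at `ωar := archOpTwo/Three …`, `har := archSideOf_ω_two/three_regime_archToAdelic …`.
KERNEL only: two data `def`s (linear operators), 0 records, 0 `def … : Prop`, nothing cited; `#print axioms` ⊆ {propext, Classical.choice, Quot.sound}.
-/

noncomputable section

open MeasureTheory MulAction IsDedekindDomain NumberField.mixedEmbedding
open NumberField hiding relNormOneIdeles relNormOneRat probHaarRelNormOneQuot
open scoped Matrix TensorProduct Classical SchwartzMap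
open Literature.NumberTheory.Automorphic Literature.NumberTheory.Automorphic.UnitaryGroup Literature.NumberTheory.Weil1964
open Literature.NumberTheory.GelbartRogawski1991 Literature.NumberTheory.GelbartRogawski1991.UnitaryDualPair
open Literature.Geometry.ComplexHyperbolic.BallModel (U21 x₀)
open Literature.AlgebraicGeometry.HodgeTheory Literature.AlgebraicGeometry.ShimuraVarieties
open Literature.NumberTheory.Automorphic.PicardCM
open Literature.NumberTheory.Transcendental (Arapura2012_Cor_15_4_6)
open HodgeCM.Adelic HodgeCM.PerL34 HodgeCM.Model.HypCensus HodgeCM.Model.ArchSideTerm HodgeCM.Model.ThetaDistFin HodgeCM.Model.TowerCarrier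
open HodgeCM.Model.SupplyInstance HodgeCM.Model.SupplyResidual HodgeCM.Model.ThetaSpace
open HodgeCM.Model.SupplyResidual.WeilPairData (charInv)

namespace HodgeCM.Model
namespace ThetaAdelicSide

/-! ### § 1. At the honest adelic side `archSideOf …`, slots 2 and 3 -/

section Honest

variable (hHD : exists_isReal_hodgeModel) (hI : hodgePQ_independent_of_hodgeModel)
  (h₁ : BallQuotientUniformised) (h₃ : CMAbelianVarietyRealised) (hA : Arapura2012_Cor_15_4_6)
variable {L : CMField} {ι₁ : L →+* ℂ} (V : HermSpace3 L ι₁) (c : SeesawCtx L)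
  (hGR : (cmSplittingDatum (L : Type) finProdFinEquiv (frameD V) (frameD_real V) (frameD_ne V) (dW c.D) (dW_real c.D)
    (dW_ne c.D)).CompatibleSplitting)
  (hGR₀ : (cmSplittingDatum (L : Type) (e₁) (frameD V) (frameD_real V) (frameD_ne V) (lineVec (L : Type) (dW c.D 0))
    (fun _ => dW_real c.D 0) (fun _ => dW_ne c.D 0)).CompatibleSplitting)
  (hGR₁ : (cmSplittingDatum (L : Type) (e₁) (frameD V) (frameD_real V) (frameD_ne V) (lineVec (L : Type) (dW c.D 1))
    (fun _ => dW_real c.D 1) (fun _ => dW_ne c.D 1)).CompatibleSplitting)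
  (hGR₂ : (cmSplittingDatum (L : Type) (e₁) (frameD V) (frameD_real V) (frameD_ne V) (lineVec (L : Type) (dW' c.D 0))
    (fun _ => dW'_real c.D 0) (fun _ => dW'_ne c.D 0)).CompatibleSplitting)
  (hGR₃ : (cmSplittingDatum (L : Type) (e₁) (frameD V) (frameD_real V) (frameD_ne V) (lineVec (L : Type) (dW' c.D 1))
    (fun _ => dW'_real c.D 1) (fun _ => dW'_ne c.D 1)).CompatibleSplitting)
  (η : CMAdelic (L : Type) (frameD V) × CMAdelic (L : Type) (dW c.D) →* ℂˣ)
  (hη : ∀ γU ∈ CMRat (L : Type) (frameD V), ∀ γ ∈ CMRat (L : Type) (dW c.D), η (γU, γ) = 1)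
  (hηc : Continuous fun p => ((η p : ℂˣ) : ℂ))
  (h₁W : (∀ j, 0 < (ι₁ (dW c.D j)).re) ∨ ∀ j, (ι₁ (dW c.D j)).re < 0)
  (A : ∀ k : Fin 4, ArchLineInput V (lineRepD V c.D hGR hGR₀ hGR₁ hGR₂ hGR₃ η k))
  (hV : IsAnisotropic L V.Hm)

/-- **The archimedean operators of slot 2** on `𝓢((L⁺ ⊗ ℝ)³)`: `aa ↦ c₂(aa′) • ω_∞(aa′, 1)` on the conjugated line `⟨dW′ 0⟩`
(carch's `archScalar_twoG` times `cmArchWeilRep … hGR₂`). -/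
def archOpTwo (aa : UnitaryGroup.arch (↥(maximalRealSubfield L)) L (IsCMField.complexConj L) 3 V.Hm) :
    𝓢((Fin 3 → mixedSpace (↥(maximalRealSubfield L))), ℂ) →ₗ[ℂ] 𝓢((Fin 3 → mixedSpace (↥(maximalRealSubfield L))), ℂ) :=
  ((archScalar_twoG V c.D hGR hGR₂ hGR₃ (eta₂ V c.D η) (archFrameCongr (L : Type) V.Hm (frameG V) (frameD V) (frame_congr V) aa) : ℂˣ) :
      ℂ) •
    (cmArchWeilRep (L : Type) e₁ (frameD V) (frameD_real V) (frameD_ne V) (lineVec (L : Type) (dW' c.D 0))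
      (fun _ => dW'_real c.D 0) (fun _ => dW'_ne c.D 0) hGR₂ (archFrameCongr (L : Type) V.Hm (frameG V) (frameD V) (frame_congr V) aa, 1) :
        𝓢((Fin 3 → mixedSpace (↥(maximalRealSubfield L))), ℂ) →ₗ[ℂ] _)

/-- **The archimedean operators of slot 3**: `aa ↦ c₃(aa′) • ω_∞(aa′, 1)` on `⟨dW′ 1⟩` (`archScalar_threeG`, `cmArchWeilRep … hGR₃`). -/
def archOpThree (aa : UnitaryGroup.arch (↥(maximalRealSubfield L)) L (IsCMField.complexConj L) 3 V.Hm) :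
    𝓢((Fin 3 → mixedSpace (↥(maximalRealSubfield L))), ℂ) →ₗ[ℂ] 𝓢((Fin 3 → mixedSpace (↥(maximalRealSubfield L))), ℂ) :=
  ((archScalar_threeG V c.D hGR hGR₂ hGR₃ (eta₃ V c.D η) (archFrameCongr (L : Type) V.Hm (frameG V) (frameD V) (frame_congr V) aa) : ℂˣ) :
      ℂ) •
    (cmArchWeilRep (L : Type) e₁ (frameD V) (frameD_real V) (frameD_ne V) (lineVec (L : Type) (dW' c.D 1))
      (fun _ => dW'_real c.D 1) (fun _ => dW'_ne c.D 1) hGR₃ (archFrameCongr (L : Type) V.Hm (frameG V) (frameD V) (frame_congr V) aa, 1) :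
        𝓢((Fin 3 → mixedSpace (↥(maximalRealSubfield L))), ℂ) →ₗ[ℂ] _)

/-- **`har` of slot 2, DISCHARGED** (carch #CA44 `lineRepOf_two_regime_archToAdelicG`, for EVERY archimedean element). -/
theorem archSideOf_ω_two_regime_archToAdelic (aa : UnitaryGroup.arch (↥(maximalRealSubfield L)) L (IsCMField.complexConj L) 3 V.Hm) :
    ((archSideOf V c hGR hGR₀ hGR₁ hGR₂ hGR₃ η hη hηc h₁W A).P 2).ω
        (HodgeCM.Adelic.regimeEquiv L V.Hm hV
          (UnitaryGroup.archToAdelic (↥(maximalRealSubfield L)) L (IsCMField.complexConj L) 3 V.Hm aa), 1) =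
      adelicTensorEnd (K := ↥(maximalRealSubfield L)) (ι := Fin 3) (archOpTwo V c hGR hGR₂ hGR₃ η aa) LinearMap.id :=
  lineRepOf_two_regime_archToAdelicG V c.D hGR hGR₀ hGR₁ hGR₂ hGR₃ (eta₀ V c.D η) (eta₁ V c.D η) (eta₂ V c.D η) (eta₃ V c.D η) hV aa

/-- **`har` of slot 3, DISCHARGED** (carch #CA44 `lineRepOf_three_regime_archToAdelicG`). -/
theorem archSideOf_ω_three_regime_archToAdelic (aa : UnitaryGroup.arch (↥(maximalRealSubfield L)) L (IsCMField.complexConj L) 3 V.Hm) :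
    ((archSideOf V c hGR hGR₀ hGR₁ hGR₂ hGR₃ η hη hηc h₁W A).P 3).ω
        (HodgeCM.Adelic.regimeEquiv L V.Hm hV
          (UnitaryGroup.archToAdelic (↥(maximalRealSubfield L)) L (IsCMField.complexConj L) 3 V.Hm aa), 1) =
      adelicTensorEnd (K := ↥(maximalRealSubfield L)) (ι := Fin 3) (archOpThree V c hGR hGR₂ hGR₃ η aa) LinearMap.id :=
  lineRepOf_three_regime_archToAdelicG V c.D hGR hGR₀ hGR₁ hGR₂ hGR₃ (eta₀ V c.D η) (eta₁ V c.D η) (eta₂ V c.D η) (eta₃ V c.D η) hV aa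

section Slots

variable
  (Φ₂ : Module.Dual ℂ (Fin 2 → ℂ) →ₗ[ℂ] 𝓢((Fin 3 → mixedSpace (↥(maximalRealSubfield L))), ℂ))
  (harm₂ : ∀ (u : ↥(stabilizer U21 x₀)) (ℓ : Module.Dual ℂ (Fin 2 → ℂ)),
    lineOmega_two V c.D hGR hGR₂ hGR₃ (eta₂ V c.D η) (u : U21) (Φ₂ ℓ) =
      Φ₂ ((BallForms.isPullbackCocycle_cotangentCocycle.weightOf x₀).dual u ℓ))
  (hdef₂ : ∀ a : UnitaryGroup.arch (↥(maximalRealSubfield L)) L (IsCMField.complexConj L) 3 V.Hm,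
    UnitaryGroup.archAt (↥(maximalRealSubfield L)) L (IsCMField.complexConj L) 3 V.Hm (UnitaryGroup.cmPlace (L : Type) ι₁)
        (NumberField.complexConj_smul_infinitePlace (L : Type) _) (IsCMField.complexConj_ne_one (L : Type)) a = 1 →
    ∀ (ℓ : Module.Dual ℂ (Fin 2 → ℂ)) (Φf : FinSB (↥(maximalRealSubfield L)) (Fin 3)),
      lineRepOf V c.D hGR hGR₀ hGR₁ hGR₂ hGR₃ (eta₀ V c.D η) (eta₁ V c.D η) (eta₂ V c.D η) (eta₃ V c.D η) 2
          (HodgeCM.Adelic.regimeEquiv L V.Hm hV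
            (UnitaryGroup.archToAdelic (↥(maximalRealSubfield L)) L (IsCMField.complexConj L) 3 V.Hm a), 1)
          (piSchwartzBruhatEquiv (↥(maximalRealSubfield L)) (Fin 3) (Φ₂ ℓ ⊗ₜ[ℂ] Φf)) =
        piSchwartzBruhatEquiv (↥(maximalRealSubfield L)) (Fin 3) (Φ₂ ℓ ⊗ₜ[ℂ] Φf))
  (Φ₃ : Module.Dual ℂ (Fin 2 → ℂ) →ₗ[ℂ] 𝓢((Fin 3 → mixedSpace (↥(maximalRealSubfield L))), ℂ))
  (harm₃ : ∀ (u : ↥(stabilizer U21 x₀)) (ℓ : Module.Dual ℂ (Fin 2 → ℂ)),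
    lineOmega_three V c.D hGR hGR₂ hGR₃ (eta₃ V c.D η) (u : U21) (Φ₃ ℓ) =
      Φ₃ ((BallForms.isPullbackCocycle_cotangentCocycle.weightOf x₀).dual u ℓ))
  (hdef₃ : ∀ a : UnitaryGroup.arch (↥(maximalRealSubfield L)) L (IsCMField.complexConj L) 3 V.Hm,
    UnitaryGroup.archAt (↥(maximalRealSubfield L)) L (IsCMField.complexConj L) 3 V.Hm (UnitaryGroup.cmPlace (L : Type) ι₁)
        (NumberField.complexConj_smul_infinitePlace (L : Type) _) (IsCMField.complexConj_ne_one (L : Type)) a = 1 →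
    ∀ (ℓ : Module.Dual ℂ (Fin 2 → ℂ)) (Φf : FinSB (↥(maximalRealSubfield L)) (Fin 3)),
      lineRepOf V c.D hGR hGR₀ hGR₁ hGR₂ hGR₃ (eta₀ V c.D η) (eta₁ V c.D η) (eta₂ V c.D η) (eta₃ V c.D η) 3
          (HodgeCM.Adelic.regimeEquiv L V.Hm hV
            (UnitaryGroup.archToAdelic (↥(maximalRealSubfield L)) L (IsCMField.complexConj L) 3 V.Hm a), 1)
          (piSchwartzBruhatEquiv (↥(maximalRealSubfield L)) (Fin 3) (Φ₃ ℓ ⊗ₜ[ℂ] Φf)) =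
        piSchwartzBruhatEquiv (↥(maximalRealSubfield L)) (Fin 3) (Φ₃ ℓ ⊗ₜ[ℂ] Φf))

/-- **Slot 2, single weight function**: modulo multiplicity one, EVERY element of `holSat Γ {f}` of slot 2 of the honest side IS
`(thetaDistDatumTwoOf …).dist f Φ_f` for one `Γ.K`-fixed finite test vector. -/
theorem exists_eq_dist_of_mem_holSat_archSideOf_two
    (hmult : ∀ a ∈ (thetaDistDatumTwoOf V c hGR hGR₀ hGR₁ hGR₂ hGR₃ η hη hηc h₁W A hV Φ₂ harm₂ hdef₂).admFamilies
      (archOpTwo V c hGR hGR₂ hGR₃ η), ∃ r : ℂ, a = r • Φ₂)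
    (Γ : Level V) (f : C(↥(relNormOneIdeles (↥(maximalRealSubfield L)) L) ⧸ relNormOneRat (↥(maximalRealSubfield L)) L, ℂ))
    {F : (V.latticeModel printFact_unitaryCompact_holds).G → (Fin 2 → ℂ)}
    (hF : F ∈ (archSideOf V c hGR hGR₀ hGR₁ hGR₂ hGR₃ η hη hηc h₁W A).holSat hV 2 Γ {f}) :
    ∃ Φf : FinSB (↥(maximalRealSubfield L)) (Fin 3), (∀ g ∈ Γ.K, finRepTwo V c.D hGR hGR₂ hGR₃ (eta₂ V c.D η) (g, 1) Φf = Φf) ∧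
      F = (thetaDistDatumTwoOf V c hGR hGR₀ hGR₁ hGR₂ hGR₃ η hη hηc h₁W A hV Φ₂ harm₂ hdef₂).dist f Φf :=
  (thetaDistDatumTwoOf V c hGR hGR₀ hGR₁ hGR₂ hGR₃ η hη hηc h₁W A hV Φ₂ harm₂ hdef₂).exists_eq_dist_of_mem_holSat
    (archOpTwo V c hGR hGR₂ hGR₃ η)
    (fun aa _ => archSideOf_ω_two_regime_archToAdelic V c hGR hGR₀ hGR₁ hGR₂ hGR₃ η hη hηc h₁W A hV aa) hmult Γ f hF

/-- **Slot 3, single weight function.** -/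
theorem exists_eq_dist_of_mem_holSat_archSideOf_three
    (hmult : ∀ a ∈ (thetaDistDatumThreeOf V c hGR hGR₀ hGR₁ hGR₂ hGR₃ η hη hηc h₁W A hV Φ₃ harm₃ hdef₃).admFamilies
      (archOpThree V c hGR hGR₂ hGR₃ η), ∃ r : ℂ, a = r • Φ₃)
    (Γ : Level V) (f : C(↥(relNormOneIdeles (↥(maximalRealSubfield L)) L) ⧸ relNormOneRat (↥(maximalRealSubfield L)) L, ℂ))
    {F : (V.latticeModel printFact_unitaryCompact_holds).G → (Fin 2 → ℂ)}
    (hF : F ∈ (archSideOf V c hGR hGR₀ hGR₁ hGR₂ hGR₃ η hη hηc h₁W A).holSat hV 3 Γ {f}) :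
    ∃ Φf : FinSB (↥(maximalRealSubfield L)) (Fin 3), (∀ g ∈ Γ.K, finRepThree V c.D hGR hGR₂ hGR₃ (eta₃ V c.D η) (g, 1) Φf = Φf) ∧
      F = (thetaDistDatumThreeOf V c hGR hGR₀ hGR₁ hGR₂ hGR₃ η hη hηc h₁W A hV Φ₃ harm₃ hdef₃).dist f Φf :=
  (thetaDistDatumThreeOf V c hGR hGR₀ hGR₁ hGR₂ hGR₃ η hη hηc h₁W A hV Φ₃ harm₃ hdef₃).exists_eq_dist_of_mem_holSat
    (archOpThree V c hGR hGR₂ hGR₃ η)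
    (fun aa _ => archSideOf_ω_three_regime_archToAdelic V c hGR hGR₀ hGR₁ hGR₂ hGR₃ η hη hηc h₁W A hV aa) hmult Γ f hF

variable
  (hd₂ : ∀ (T : 𝓢((Fin 3 → mixedSpace (↥(maximalRealSubfield L))), ℂ) →L[ℂ] ℂ) (ℓ : Module.Dual ℂ (Fin 2 → ℂ)),
    DifferentiableAt ℝ (fun b => T (lineOmega_two V c.D hGR hGR₂ hGR₃ (eta₂ V c.D η) (BallForms.expP b) (Φ₂ ℓ))) 0)
  (hCR₂ : ∀ (T : 𝓢((Fin 3 → mixedSpace (↥(maximalRealSubfield L))), ℂ) →L[ℂ] ℂ) (ℓ : Module.Dual ℂ (Fin 2 → ℂ)) (v : Fin 2 → ℂ),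
    fderiv ℝ (fun b => T (lineOmega_two V c.D hGR hGR₂ hGR₃ (eta₂ V c.D η) (BallForms.expP b) (Φ₂ ℓ))) 0 (Complex.I • v) =
      Complex.I • fderiv ℝ (fun b => T (lineOmega_two V c.D hGR hGR₂ hGR₃ (eta₂ V c.D η) (BallForms.expP b) (Φ₂ ℓ))) 0 v)
  (hd₃ : ∀ (T : 𝓢((Fin 3 → mixedSpace (↥(maximalRealSubfield L))), ℂ) →L[ℂ] ℂ) (ℓ : Module.Dual ℂ (Fin 2 → ℂ)),
    DifferentiableAt ℝ (fun b => T (lineOmega_three V c.D hGR hGR₂ hGR₃ (eta₃ V c.D η) (BallForms.expP b) (Φ₃ ℓ))) 0)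
  (hCR₃ : ∀ (T : 𝓢((Fin 3 → mixedSpace (↥(maximalRealSubfield L))), ℂ) →L[ℂ] ℂ) (ℓ : Module.Dual ℂ (Fin 2 → ℂ)) (v : Fin 2 → ℂ),
    fderiv ℝ (fun b => T (lineOmega_three V c.D hGR hGR₂ hGR₃ (eta₃ V c.D η) (BallForms.expP b) (Φ₃ ℓ))) 0 (Complex.I • v) =
      Complex.I • fderiv ℝ (fun b => T (lineOmega_three V c.D hGR hGR₂ hGR₃ (eta₃ V c.D η) (BallForms.expP b) (Φ₃ ℓ))) 0 v)
  {𝓕 : Set C(↥(relNormOneIdeles (↥(maximalRealSubfield L)) L) ⧸ relNormOneRat (↥(maximalRealSubfield L)) L, ℂ)}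
  (h𝓕 : ∀ f ∈ 𝓕, ∃ χ : PontryaginDual (↥(relNormOneIdeles (↥(maximalRealSubfield L)) L) ⧸ relNormOneRat (↥(maximalRealSubfield L)) L),
    f = charInv χ)

include hd₂ hCR₂ h𝓕 in
/-- **`hfam` clause 2 for EVERY saturated hol-germ theta form of slot 2 of the honest side, modulo multiplicity one** (family form
`hmult`): for weight functions `𝓕 ⊆ {charInv χ}` and every `F ∈ holSat Γ 𝓕` of slot 2 of `archSideOf …`, `F ∈ holSatU` and its tower class
lies in `⨆_{χ, charInv χ ∈ 𝓕} block(Ω(χ))`, `Ω(χ) = ((thetaDistDatumTwoOf …).coinvRep χ).asModule`. -/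
theorem clsU_mem_iSup_block_of_mem_holSat_archSideOf_two
    (hmult : ∀ a ∈ (thetaDistDatumTwoOf V c hGR hGR₀ hGR₁ hGR₂ hGR₃ η hη hηc h₁W A hV Φ₂ harm₂ hdef₂).admFamilies
      (archOpTwo V c hGR hGR₂ hGR₃ η), ∃ r : ℂ, a = r • Φ₂)
    (hι : (archSideOf V c hGR hGR₀ hGR₁ hGR₂ hGR₃ η hη hηc h₁W A).ιinf = archInfOf V) (Γ : Level V)
    {F : (V.latticeModel printFact_unitaryCompact_holds).G → (Fin 2 → ℂ)}
    (hF : F ∈ (archSideOf V c hGR hGR₀ hGR₁ hGR₂ hGR₃ η hη hηc h₁W A).holSat hV 2 Γ 𝓕) :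
    ∃ hF' : F ∈ (archSideOf V c hGR hGR₀ hGR₁ hGR₂ hGR₃ η hη hηc h₁W A).holSatU hV 2 𝓕,
      (archSideOf V c hGR hGR₀ hGR₁ hGR₂ hGR₃ η hη hηc h₁W A).clsU hHD hI h₁ h₃ hA 𝓕 hι hV 2 ⟨F, hF'⟩ ∈
        ⨆ (χ : PontryaginDual (↥(relNormOneIdeles (↥(maximalRealSubfield L)) L) ⧸ relNormOneRat (↥(maximalRealSubfield L)) L))
          (_ : charInv χ ∈ 𝓕),
          ⨆ ψ : ((thetaDistDatumTwoOf V c hGR hGR₀ hGR₁ hGR₂ hGR₃ η hη hηc h₁W A hV Φ₂ harm₂ hdef₂).coinvRep χ).asModule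
              →ₗ[MonoidAlgebra ℂ ↥V.adelicFin] Tower hHD hI (ballQuotientUniformisedDatum_of h₁) h₃ hA V,
            (LinearMap.range ψ).restrictScalars ℂ :=
  (thetaDistDatumTwoOf V c hGR hGR₀ hGR₁ hGR₂ hGR₃ η hη hηc h₁W A hV Φ₂ harm₂ hdef₂).clsU_mem_iSup_block_of_mem_holSat_of_multOne
    hHD hI h₁ h₃ hA (archOpTwo V c hGR hGR₂ hGR₃ η)
    (fun aa _ => archSideOf_ω_two_regime_archToAdelic V c hGR hGR₀ hGR₁ hGR₂ hGR₃ η hη hηc h₁W A hV aa) hmult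
    (satG_le_archSideOf_Gfin V c hGR hGR₀ hGR₁ hGR₂ hGR₃ η hη hηc h₁W A hV)
    (isLFAction_archSideOf V c hGR hGR₀ hGR₁ hGR₂ hGR₃ η hη hηc h₁W A 2) hd₂ hCR₂ h𝓕 hι Γ hF

include hd₃ hCR₃ h𝓕 in
/-- **`hfam` clause 2 for EVERY saturated hol-germ theta form of slot 3 of the honest side, modulo multiplicity one.** -/
theorem clsU_mem_iSup_block_of_mem_holSat_archSideOf_three
    (hmult : ∀ a ∈ (thetaDistDatumThreeOf V c hGR hGR₀ hGR₁ hGR₂ hGR₃ η hη hηc h₁W A hV Φ₃ harm₃ hdef₃).admFamilies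
      (archOpThree V c hGR hGR₂ hGR₃ η), ∃ r : ℂ, a = r • Φ₃)
    (hι : (archSideOf V c hGR hGR₀ hGR₁ hGR₂ hGR₃ η hη hηc h₁W A).ιinf = archInfOf V) (Γ : Level V)
    {F : (V.latticeModel printFact_unitaryCompact_holds).G → (Fin 2 → ℂ)}
    (hF : F ∈ (archSideOf V c hGR hGR₀ hGR₁ hGR₂ hGR₃ η hη hηc h₁W A).holSat hV 3 Γ 𝓕) :
    ∃ hF' : F ∈ (archSideOf V c hGR hGR₀ hGR₁ hGR₂ hGR₃ η hη hηc h₁W A).holSatU hV 3 𝓕,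
      (archSideOf V c hGR hGR₀ hGR₁ hGR₂ hGR₃ η hη hηc h₁W A).clsU hHD hI h₁ h₃ hA 𝓕 hι hV 3 ⟨F, hF'⟩ ∈
        ⨆ (χ : PontryaginDual (↥(relNormOneIdeles (↥(maximalRealSubfield L)) L) ⧸ relNormOneRat (↥(maximalRealSubfield L)) L))
          (_ : charInv χ ∈ 𝓕),
          ⨆ ψ : ((thetaDistDatumThreeOf V c hGR hGR₀ hGR₁ hGR₂ hGR₃ η hη hηc h₁W A hV Φ₃ harm₃ hdef₃).coinvRep χ).asModule
              →ₗ[MonoidAlgebra ℂ ↥V.adelicFin] Tower hHD hI (ballQuotientUniformisedDatum_of h₁) h₃ hA V,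
            (LinearMap.range ψ).restrictScalars ℂ :=
  (thetaDistDatumThreeOf V c hGR hGR₀ hGR₁ hGR₂ hGR₃ η hη hηc h₁W A hV Φ₃ harm₃ hdef₃).clsU_mem_iSup_block_of_mem_holSat_of_multOne
    hHD hI h₁ h₃ hA (archOpThree V c hGR hGR₂ hGR₃ η)
    (fun aa _ => archSideOf_ω_three_regime_archToAdelic V c hGR hGR₀ hGR₁ hGR₂ hGR₃ η hη hηc h₁W A hV aa) hmult
    (satG_le_archSideOf_Gfin V c hGR hGR₀ hGR₁ hGR₂ hGR₃ η hη hηc h₁W A hV)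
    (isLFAction_archSideOf V c hGR hGR₀ hGR₁ hGR₂ hGR₃ η hη hηc h₁W A 3) hd₃ hCR₃ h𝓕 hι Γ hF

include hd₂ hCR₂ h𝓕 in
/-- The same for slot 2 with the multiplicity-one input in RANK form (`Module.rank ℂ ↥(admFamilies …) ≤ 1`) and `Φarch ≠ 0`. -/
theorem clsU_mem_iSup_block_of_mem_holSat_archSideOf_two_of_rank_le_one (hΦ : Φ₂ ≠ 0)
    (hrk : Module.rank ℂ ↥((thetaDistDatumTwoOf V c hGR hGR₀ hGR₁ hGR₂ hGR₃ η hη hηc h₁W A hV Φ₂ harm₂ hdef₂).admFamilies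
      (archOpTwo V c hGR hGR₂ hGR₃ η)) ≤ 1)
    (hι : (archSideOf V c hGR hGR₀ hGR₁ hGR₂ hGR₃ η hη hηc h₁W A).ιinf = archInfOf V) (Γ : Level V)
    {F : (V.latticeModel printFact_unitaryCompact_holds).G → (Fin 2 → ℂ)}
    (hF : F ∈ (archSideOf V c hGR hGR₀ hGR₁ hGR₂ hGR₃ η hη hηc h₁W A).holSat hV 2 Γ 𝓕) :
    ∃ hF' : F ∈ (archSideOf V c hGR hGR₀ hGR₁ hGR₂ hGR₃ η hη hηc h₁W A).holSatU hV 2 𝓕,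
      (archSideOf V c hGR hGR₀ hGR₁ hGR₂ hGR₃ η hη hηc h₁W A).clsU hHD hI h₁ h₃ hA 𝓕 hι hV 2 ⟨F, hF'⟩ ∈
        ⨆ (χ : PontryaginDual (↥(relNormOneIdeles (↥(maximalRealSubfield L)) L) ⧸ relNormOneRat (↥(maximalRealSubfield L)) L))
          (_ : charInv χ ∈ 𝓕),
          ⨆ ψ : ((thetaDistDatumTwoOf V c hGR hGR₀ hGR₁ hGR₂ hGR₃ η hη hηc h₁W A hV Φ₂ harm₂ hdef₂).coinvRep χ).asModule
              →ₗ[MonoidAlgebra ℂ ↥V.adelicFin] Tower hHD hI (ballQuotientUniformisedDatum_of h₁) h₃ hA V,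
            (LinearMap.range ψ).restrictScalars ℂ :=
  clsU_mem_iSup_block_of_mem_holSat_archSideOf_two hHD hI h₁ h₃ hA V c hGR hGR₀ hGR₁ hGR₂ hGR₃ η hη hηc h₁W A hV Φ₂ harm₂ hdef₂ hd₂ hCR₂ h𝓕
    ((thetaDistDatumTwoOf V c hGR hGR₀ hGR₁ hGR₂ hGR₃ η hη hηc h₁W A hV Φ₂ harm₂ hdef₂).multOne_of_rank_le_one
      (archOpTwo V c hGR hGR₂ hGR₃ η)
      (fun aa _ => archSideOf_ω_two_regime_archToAdelic V c hGR hGR₀ hGR₁ hGR₂ hGR₃ η hη hηc h₁W A hV aa) hΦ hrk) hι Γ hF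

include hd₃ hCR₃ h𝓕 in
/-- The same for slot 3 with the multiplicity-one input in RANK form. -/
theorem clsU_mem_iSup_block_of_mem_holSat_archSideOf_three_of_rank_le_one (hΦ : Φ₃ ≠ 0)
    (hrk : Module.rank ℂ ↥((thetaDistDatumThreeOf V c hGR hGR₀ hGR₁ hGR₂ hGR₃ η hη hηc h₁W A hV Φ₃ harm₃ hdef₃).admFamilies
      (archOpThree V c hGR hGR₂ hGR₃ η)) ≤ 1)
    (hι : (archSideOf V c hGR hGR₀ hGR₁ hGR₂ hGR₃ η hη hηc h₁W A).ιinf = archInfOf V) (Γ : Level V)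
    {F : (V.latticeModel printFact_unitaryCompact_holds).G → (Fin 2 → ℂ)}
    (hF : F ∈ (archSideOf V c hGR hGR₀ hGR₁ hGR₂ hGR₃ η hη hηc h₁W A).holSat hV 3 Γ 𝓕) :
    ∃ hF' : F ∈ (archSideOf V c hGR hGR₀ hGR₁ hGR₂ hGR₃ η hη hηc h₁W A).holSatU hV 3 𝓕,
      (archSideOf V c hGR hGR₀ hGR₁ hGR₂ hGR₃ η hη hηc h₁W A).clsU hHD hI h₁ h₃ hA 𝓕 hι hV 3 ⟨F, hF'⟩ ∈
        ⨆ (χ : PontryaginDual (↥(relNormOneIdeles (↥(maximalRealSubfield L)) L) ⧸ relNormOneRat (↥(maximalRealSubfield L)) L))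
          (_ : charInv χ ∈ 𝓕),
          ⨆ ψ : ((thetaDistDatumThreeOf V c hGR hGR₀ hGR₁ hGR₂ hGR₃ η hη hηc h₁W A hV Φ₃ harm₃ hdef₃).coinvRep χ).asModule
              →ₗ[MonoidAlgebra ℂ ↥V.adelicFin] Tower hHD hI (ballQuotientUniformisedDatum_of h₁) h₃ hA V,
            (LinearMap.range ψ).restrictScalars ℂ :=
  clsU_mem_iSup_block_of_mem_holSat_archSideOf_three hHD hI h₁ h₃ hA V c hGR hGR₀ hGR₁ hGR₂ hGR₃ η hη hηc h₁W A hV Φ₃ harm₃ hdef₃ hd₃ hCR₃ h𝓕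
    ((thetaDistDatumThreeOf V c hGR hGR₀ hGR₁ hGR₂ hGR₃ η hη hηc h₁W A hV Φ₃ harm₃ hdef₃).multOne_of_rank_le_one
      (archOpThree V c hGR hGR₂ hGR₃ η)
      (fun aa _ => archSideOf_ω_three_regime_archToAdelic V c hGR hGR₀ hGR₁ hGR₂ hGR₃ η hη hηc h₁W A hV aa) hΦ hrk) hι Γ hF

/-! ### § 2. The end statements with `hrk` struck (carch #CA68 supplies the slot-2/3 multiplicity-one input) -/

include hd₂ hCR₂ h𝓕 in
/-- **Slot 2, NO multiplicity-one hypothesis**: the tower class of every saturated hol-germ theta form of slot 2 of the honest side lies in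
`⨆_{χ, charInv χ ∈ 𝓕} block(Ω₂(χ))`, given only `Φarch ≠ 0`, the (a4)/(a5) inputs `hd`/`hCR`, `h𝓕`, `hι`. -/
theorem clsU_mem_iSup_block_of_mem_holSat_archSideOf_two_of_ne_zero (hΦ : Φ₂ ≠ 0)
    (hι : (archSideOf V c hGR hGR₀ hGR₁ hGR₂ hGR₃ η hη hηc h₁W A).ιinf = archInfOf V) (Γ : Level V)
    {F : (V.latticeModel printFact_unitaryCompact_holds).G → (Fin 2 → ℂ)}
    (hF : F ∈ (archSideOf V c hGR hGR₀ hGR₁ hGR₂ hGR₃ η hη hηc h₁W A).holSat hV 2 Γ 𝓕) :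
    ∃ hF' : F ∈ (archSideOf V c hGR hGR₀ hGR₁ hGR₂ hGR₃ η hη hηc h₁W A).holSatU hV 2 𝓕,
      (archSideOf V c hGR hGR₀ hGR₁ hGR₂ hGR₃ η hη hηc h₁W A).clsU hHD hI h₁ h₃ hA 𝓕 hι hV 2 ⟨F, hF'⟩ ∈
        ⨆ (χ : PontryaginDual (↥(relNormOneIdeles (↥(maximalRealSubfield L)) L) ⧸ relNormOneRat (↥(maximalRealSubfield L)) L))
          (_ : charInv χ ∈ 𝓕),
          ⨆ ψ : ((thetaDistDatumTwoOf V c hGR hGR₀ hGR₁ hGR₂ hGR₃ η hη hηc h₁W A hV Φ₂ harm₂ hdef₂).coinvRep χ).asModule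
              →ₗ[MonoidAlgebra ℂ ↥V.adelicFin] Tower hHD hI (ballQuotientUniformisedDatum_of h₁) h₃ hA V,
            (LinearMap.range ψ).restrictScalars ℂ :=
  clsU_mem_iSup_block_of_mem_holSat_archSideOf_two_of_rank_le_one hHD hI h₁ h₃ hA V c hGR hGR₀ hGR₁ hGR₂ hGR₃ η hη hηc h₁W A hV
    Φ₂ harm₂ hdef₂ hd₂ hCR₂ h𝓕 hΦ
    (rank_admFamilies_thetaDistDatumTwoOf_le_one V c hGR hGR₀ hGR₁ hGR₂ hGR₃ η hη hηc h₁W A hV (archOpTwo V c hGR hGR₂ hGR₃ η) Φ₂ harm₂ hdef₂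
      fun aa _ => archSideOf_ω_two_regime_archToAdelic V c hGR hGR₀ hGR₁ hGR₂ hGR₃ η hη hηc h₁W A hV aa) hι Γ hF

include hd₃ hCR₃ h𝓕 in
/-- **Slot 3, NO multiplicity-one hypothesis.** -/
theorem clsU_mem_iSup_block_of_mem_holSat_archSideOf_three_of_ne_zero (hΦ : Φ₃ ≠ 0)
    (hι : (archSideOf V c hGR hGR₀ hGR₁ hGR₂ hGR₃ η hη hηc h₁W A).ιinf = archInfOf V) (Γ : Level V)
    {F : (V.latticeModel printFact_unitaryCompact_holds).G → (Fin 2 → ℂ)}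
    (hF : F ∈ (archSideOf V c hGR hGR₀ hGR₁ hGR₂ hGR₃ η hη hηc h₁W A).holSat hV 3 Γ 𝓕) :
    ∃ hF' : F ∈ (archSideOf V c hGR hGR₀ hGR₁ hGR₂ hGR₃ η hη hηc h₁W A).holSatU hV 3 𝓕,
      (archSideOf V c hGR hGR₀ hGR₁ hGR₂ hGR₃ η hη hηc h₁W A).clsU hHD hI h₁ h₃ hA 𝓕 hι hV 3 ⟨F, hF'⟩ ∈
        ⨆ (χ : PontryaginDual (↥(relNormOneIdeles (↥(maximalRealSubfield L)) L) ⧸ relNormOneRat (↥(maximalRealSubfield L)) L))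
          (_ : charInv χ ∈ 𝓕),
          ⨆ ψ : ((thetaDistDatumThreeOf V c hGR hGR₀ hGR₁ hGR₂ hGR₃ η hη hηc h₁W A hV Φ₃ harm₃ hdef₃).coinvRep χ).asModule
              →ₗ[MonoidAlgebra ℂ ↥V.adelicFin] Tower hHD hI (ballQuotientUniformisedDatum_of h₁) h₃ hA V,
            (LinearMap.range ψ).restrictScalars ℂ :=
  clsU_mem_iSup_block_of_mem_holSat_archSideOf_three_of_rank_le_one hHD hI h₁ h₃ hA V c hGR hGR₀ hGR₁ hGR₂ hGR₃ η hη hηc h₁W A hV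
    Φ₃ harm₃ hdef₃ hd₃ hCR₃ h𝓕 hΦ
    (rank_admFamilies_thetaDistDatumThreeOf_le_one V c hGR hGR₀ hGR₁ hGR₂ hGR₃ η hη hηc h₁W A hV (archOpThree V c hGR hGR₂ hGR₃ η) Φ₃ harm₃ hdef₃
      fun aa _ => archSideOf_ω_three_regime_archToAdelic V c hGR hGR₀ hGR₁ hGR₂ hGR₃ η hη hηc h₁W A hV aa) hι Γ hF

end Slots

end Honest

end ThetaAdelicSide
end HodgeCM.Model

end
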